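import Summits.CriticalPhenomena.CardyFormulaZ2.Theorems.CardyIKTransportIKMixedBoxCrossingDefs
import Summits.CriticalPhenomena.CardyFormulaZ2.Theorems.CardyIKTransportIKQuarterTurn

/-!
# Stub `stub_quarterTurn` of the line `paired-mirror-exploration` (crux `IKMixedBoxCrossing`,
# stmt-CriticalPhenomena-5911)

The exact quarter-turn symmetry of the isotropic (`S = univ`) Izergin–Korepin gauge at the level of box
crossings: the bottom–top crossing probability of the `w × h` box `[0, w) × [0, h)` equals the left–right
crossing probability of the `h × w` box `[1 - h, 1) × [0, w)`,
`pTB univ 0 0 w h = pLR univ (1 - h) 0 h w` (`stub_quarterTurn`).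

PROOF. The landed bit bijection `Φ : Ω ≃ᵐ Ω` (`Theorems/CardyIKTransportIKQuarterTurnBijection.lean`)
preserves `μIK` (`measurePreserving_Φ`) and carries the open edge set to its image under the quarter-turn
`rot v = (-v₁, v₀)` (`blackEdges_obs_Φ`, `Theorems/CardyIKTransportIKQuarterTurn.lean`). The quarter-turn
maps the box `[0, w) × [0, h)` onto `[1 - h, 1) × [0, w)`, its top row onto the left column `{v₀ = 1 - h}`
and its bottom row onto the right column `{v₀ = 0}` (`image_rot_qtBox`, `image_rot_qtTop`,
`image_rot_qtBot`), so the LR crossing event of the turned box pulls back along `Φ` to the BT crossing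
event of the original box (`preimage_relabel_openCrossing` of `LatticeSymmetry.lean` and `openCrossing_comm` of
`RSWProofs.lean`); the identity of measures is `MeasurableEquiv.map_apply` and
`measurePreserving_Φ.map_eq` (no measurability of the events is needed). Elementary; no literature fact.
-/

noncomputable section

namespace Summit.CriticalPhenomena.CardyFormulaZ2.Cruxes.IKMixedBoxCrossing.PairedMirrorExploration

open MeasureTheory Set
open Literature.Probability.Percolation Literature.Probability.LatticeModels
open Summit.CriticalPhenomena.CardyFormulaZ2.Theorems.IKLinearTransport.PinnedDiagramExchange
  (Ω μIK parSet blackSet antiSet Obs obs νmix blackEdges lrCross tbCross)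
open Summit.CriticalPhenomena.CardyFormulaZ2.Theorems.IKQuarterTurn

namespace QuarterTurnStub

/-! ## §1 The box, its bottom and top rows, and their quarter-turn images -/

/-- The box `[0, w) × [0, h)` of `tbCross 0 0 w h` (verbatim). [folklore] -/
def qtBox (w h : ℕ) : Set (Site 2) :=
  {v | (0 : ℤ) ≤ v 0 ∧ v 0 < 0 + (w : ℤ) ∧ (0 : ℤ) ≤ v 1 ∧ v 1 < 0 + (h : ℤ)}

/-- The bottom row of the box `[0, w) × [0, h)` (verbatim from `tbCross 0 0 w h`). [folklore] -/
def qtBot (w : ℕ) : Set (Site 2) :=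
  {v | v 1 = (0 : ℤ) ∧ (0 : ℤ) ≤ v 0 ∧ v 0 < 0 + (w : ℤ)}

/-- The top row of the box `[0, w) × [0, h)` (verbatim from `tbCross 0 0 w h`). [folklore] -/
def qtTop (w h : ℕ) : Set (Site 2) :=
  {v | v 1 = 0 + (h : ℤ) - 1 ∧ (0 : ℤ) ≤ v 0 ∧ v 0 < 0 + (w : ℤ)}

/-- `tbCross 0 0 w h` in terms of the named box and rows (definitional). [folklore] -/
theorem tbCross_zero_zero (w h : ℕ) :
    tbCross 0 0 w h = {x | blackEdges x ∈ openCrossing (qtBox w h) (qtBot w) (qtTop w h)} :=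
  rfl

/-- The quarter-turn of the box `[0, w) × [0, h)` is the box `[1 - h, 1) × [0, w)`. [folklore] -/
theorem image_rot_qtBox (w h : ℕ) :
    rot '' qtBox w h =
      {v : Site 2 | 1 - (h : ℤ) ≤ v 0 ∧ v 0 < 1 - (h : ℤ) + (h : ℤ) ∧ (0 : ℤ) ≤ v 1 ∧ v 1 < 0 + (w : ℤ)} := by
  rw [Equiv.image_eq_preimage_symm]
  ext v
  simp only [qtBox, mem_preimage, mem_setOf_eq, rot_symm_apply_zero, rot_symm_apply_one]
  omega

/-- The quarter-turn of the top row is the left column `{v₀ = 1 - h}` of the turned box. [folklore] -/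
theorem image_rot_qtTop (w h : ℕ) :
    rot '' qtTop w h = {v : Site 2 | v 0 = 1 - (h : ℤ) ∧ (0 : ℤ) ≤ v 1 ∧ v 1 < 0 + (w : ℤ)} := by
  rw [Equiv.image_eq_preimage_symm]
  ext v
  simp only [qtTop, mem_preimage, mem_setOf_eq, rot_symm_apply_zero, rot_symm_apply_one]
  omega

/-- The quarter-turn of the bottom row is the right column `{v₀ = (1 - h) + h - 1}` of the turned box.
[folklore] -/
theorem image_rot_qtBot (w h : ℕ) :
    rot '' qtBot w = {v : Site 2 | v 0 = 1 - (h : ℤ) + (h : ℤ) - 1 ∧ (0 : ℤ) ≤ v 1 ∧ v 1 < 0 + (w : ℤ)} := by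
  rw [Equiv.image_eq_preimage_symm]
  ext v
  simp only [qtBot, mem_preimage, mem_setOf_eq, rot_symm_apply_zero, rot_symm_apply_one]
  omega

/-- `lrCross (1 - h) 0 h w` is the crossing event of the turned box between the turned top row and the
turned bottom row. [folklore] -/
theorem lrCross_one_sub (w h : ℕ) :
    lrCross (1 - (h : ℤ)) 0 h w =
      {x | blackEdges x ∈ openCrossing (rot '' qtBox w h) (rot '' qtTop w h) (rot '' qtBot w)} := by
  rw [image_rot_qtBox, image_rot_qtTop, image_rot_qtBot w h]
  rfl

/-! ## §2 The LR event of the turned box pulls back along `Φ` to the BT event -/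

/-- THE PULL-BACK: `Φ ⁻¹' {LR crossing of [1-h, 1) × [0, w)} = {BT crossing of [0, w) × [0, h)}` at
`S = univ`. [folklore] -/
theorem preimage_Φ_lrCross (w h : ℕ) :
    Φ ⁻¹' (obs Set.univ ⁻¹' lrCross (1 - (h : ℤ)) 0 h w) = obs Set.univ ⁻¹' tbCross 0 0 w h := by
  ext ω
  rw [mem_preimage, mem_preimage, mem_preimage, lrCross_one_sub, tbCross_zero_zero, mem_setOf_eq,
    mem_setOf_eq, blackEdges_obs_Φ, ← mem_preimage, preimage_relabel_openCrossing, openCrossing_comm]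

end QuarterTurnStub

open QuarterTurnStub in
/-- **Stub `stub_quarterTurn`** (line `paired-mirror-exploration`, crux stmt-CriticalPhenomena-5911): the
exact quarter-turn symmetry of the isotropic gauge on box crossings,
`P_univ[BT([0, w) × [0, h))] = P_univ[LR([1 - h, 1) × [0, w))]`. [folklore] -/
theorem stub_quarterTurn :
    ∀ w h : ℕ, pTB Set.univ 0 0 w h = pLR Set.univ (1 - (h : ℤ)) 0 h w := by
  intro w h
  rw [pTB, pLR, ← preimage_Φ_lrCross, measureReal_def, measureReal_def, ← MeasurableEquiv.map_apply Φ,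
    measurePreserving_Φ.map_eq]

end Summit.CriticalPhenomena.CardyFormulaZ2.Cruxes.IKMixedBoxCrossing.PairedMirrorExploration

end
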